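import Literature.Probability.RandomPlanarGeometry.HullThickening
import HarnessLib

/-!
# From restriction over smooth hulls to `𝒜₁`-covariance for all `*`-hulls ([LSW] Prop. 3.3 (1))

Proof-only file. The uniqueness half of [LSW] p. 5 result 2
(`Literature.Probability.RandomPlanarGeometry.LawlerSchrammWerner2003_unique`, `ConformalRestrictionProofs`) pulls a chordal curve
family back to a probability measure `P` on `Ω` and needs hypothesis (1) of

* G. F. Lawler, O. Schramm, W. Werner, *Conformal restriction: the chordal case*, J. Amer.
  Math. Soc. **16** (2003) 917–955, arXiv:math/0209343 (**[LSW]**), Prop. 3.3 (p. 10),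

in the homomorphism form `RestrictionConfig.IsHullMultiplicative P`
(`F(A · A') = F(A) F(A')` for ALL `A, A' ∈ 𝒬*`, `F(A) = P[K ∩ A = ∅]`), whereas restriction over
Jordan hull subdomains only yields it for SMOOTH `A'` (`RestrictionConfig.IsArcHullMultiplicative`,
`HullApproximation`). This file PROVES the upgrade

* `Literature.Probability.RandomPlanarGeometry.RestrictionConfig.IsArcHullMultiplicative.isHullMultiplicative`:
  `IsArcHullMultiplicative P → IsHullMultiplicative P` for a probability measure `P` on `Ω`,

from the named facts of `HullApproximation` ([LSW] Lemma 2.1 with the Lemma 3.5 convergence: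
smooth `J_n ↓ A'` with `Φ_{J_n} → Φ_{A'}` uniformly on compacts of `ℍ̄ ∖ A'`, for nonempty
`A' ∈ 𝒬₊`, by reflection for `𝒬₋`; the factorisation `A' = A₁ · A₂`, `A₁ ∈ 𝒬₊`, `A₂ ∈ 𝒬₋`,
§2 p. 8) together with the
existence of `Φ_A` (`IsStarHull.existsUnique_isRestrictionMap`) and the classical criterion
`isSimplyConnected_of_isConnected_compl` (for the thickened hulls).

## The limit argument (`measure_avoid_hullProduct_of_hasArcApprox`)

Fix `A ∈ 𝒬*` and `A' ∈ 𝒬₊ ∪ 𝒬₋` with smooth `J_n ↓ A'`, restriction maps `Ψ_n → Φ' = Φ_{A'}`.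
Let `T_s = thickHull A s ∈ 𝒬*` (`HullThickening`), `s ↓ 0`, and
`C_s = {K ∩ A' = ∅, Φ'(K) ∩ T_s = ∅}` (`= {K ∩ (T_s · A') = ∅}`). For `s < s'`:

* `P(C_s) ≤ F(T_s) F(A')` — every `K ∈ C_s` lies in `{K ∩ (T_s · J_n) = ∅}` for all large `n`
  (`eventually_mem_avoid_hullProduct`: `K` misses `J_n` eventually by compactness; `Ψ_n(K)`
  misses `T_s` eventually, by uniform convergence on `K ∩ B(0, R)` at positive distance of
  `Φ'(K ∩ B(0,R)) ∪ {0}` from `T_s`, and by the uniform far-field bound beyond `R`), and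
  `P{K ∩ (T_s · J_n) = ∅} = F(T_s) F(J_n) → F(T_s) F(A')` by smooth multiplicativity;
* `F(T_{s'}) F(A') ≤ P(C_s)` — if `K ∩ (T_{s'} · J_n) = ∅` for infinitely many `n` then
  `K ∈ C_s` (`mem_of_frequently_mem_avoid_hullProduct`: a point `Φ'(z) ∈ T_s ∩ ℍ ⊆ int T_{s'}`
  would force `Ψ_n(z) ∈ T_{s'}` for all large `n` by pointwise convergence).

As `s ↓ 0`, `F(T_s) ↑ F(A)` and `P(C_s) ↑ F(A · A')` (outer continuity of avoidance for the
connected unbounded sets `K` and `Φ'(K)`, whose closures meet `ℝ` only at `0 ∉ A`), whence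
`F(A · A') = F(A) F(A')`. Touching events never need to be controlled: monotonicity in `s` does
it. The general `A' ∈ 𝒬*` follows by `A' = A₁ · A₂` and associativity of the hull product
(`hullProduct_assoc`).
-/

noncomputable section

open Set Filter Topology Metric Bornology Complex MeasureTheory
open UpperHalfPlane (upperHalfPlaneSet isOpen_upperHalfPlaneSet)
open scoped NNReal ENNReal

namespace Literature.Probability.RandomPlanarGeometry

namespace RestrictionConfig

/-! ### Configurations: closure, avoidance of product hulls -/

/-- The closure of a configuration adds at most the origin: `cl K ⊆ K ∪ {0}`. [folklore] -/
theorem closure_subset (K : RestrictionConfig) : closure (K : Set ℂ) ⊆ (K : Set ℂ) ∪ {0} := by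
  intro z hz
  have hzcl : z ∈ closure upperHalfPlaneSet := closure_mono K.subset_upperHalfPlaneSet hz
  rw [Complex.closure_setOf_lt_im] at hzcl
  rcases (show 0 ≤ z.im from hzcl).lt_or_eq with h | h
  · exact Or.inl (K.closure_inter_eq ▸ ⟨hz, h⟩)
  · right
    have hzr : z ∈ range ((↑) : ℝ → ℂ) := ⟨z.re, Complex.ext (by simp) (by simp [← h])⟩
    have : z ∈ closure (K : Set ℂ) ∩ range ((↑) : ℝ → ℂ) := ⟨hz, hzr⟩
    rwa [K.closure_inter_range_ofReal] at this

/-- A configuration is unbounded. [folklore] -/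
theorem not_isBounded (K : RestrictionConfig) : ¬ IsBounded (K : Set ℂ) :=
  K.2.2.2.2.1

/-- A configuration avoiding `A'` lies in `ℍ ∖ A'`. [folklore] -/
theorem subset_diff_of_disjoint (K : RestrictionConfig) {A' : Set ℂ}
    (h : Disjoint (K : Set ℂ) A') : (K : Set ℂ) ⊆ upperHalfPlaneSet \ A' :=
  fun _ hz ↦ ⟨K.subset_upperHalfPlaneSet hz, Set.disjoint_left.1 h hz⟩

/-- The closure of a configuration avoiding `A ∌ 0` misses `A`. [folklore] -/
theorem disjoint_closure_of_disjoint (K : RestrictionConfig) {A : Set ℂ} (h0 : (0 : ℂ) ∉ A)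
    (h : Disjoint (K : Set ℂ) A) : Disjoint (closure (K : Set ℂ)) A := by
  rw [Set.disjoint_left]
  intro z hz hzA
  rcases K.closure_subset hz with hzK | hz0
  · exact Set.disjoint_left.1 h hzK hzA
  · rw [mem_singleton_iff] at hz0
    exact h0 (hz0 ▸ hzA)

variable {T A₂ : Set ℂ} {Φ₂ : ConformalEquiv (upperHalfPlaneSet \ A₂) upperHalfPlaneSet}

/-- **Avoiding a product hull `T · A₂`** is avoiding `A₂` and being mapped off `T` by `Φ_{A₂}`
(`ℍ ∖ (T · A₂) = Φ_{A₂}⁻¹(ℍ ∖ T)`). [cite: LawlerSchrammWerner2003Restriction, §2 p. 8 (Semigroups)] -/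
theorem mem_avoid_hullProduct_iff (hT : IsClosed T) (hA₂ : IsClosed A₂) {K : RestrictionConfig} :
    K ∈ avoid (hullProduct T A₂ Φ₂) ↔
      Disjoint (K : Set ℂ) A₂ ∧ ∀ z ∈ (K : Set ℂ), Φ₂ z ∉ T := by
  rw [mem_avoid, Set.disjoint_left, Set.disjoint_left]
  constructor
  · intro h
    exact ⟨fun z hz ↦ ((notMem_hullProduct_iff hT hA₂ (K.subset_upperHalfPlaneSet hz)).1 (h hz)).1,
      fun z hz ↦ ((notMem_hullProduct_iff hT hA₂ (K.subset_upperHalfPlaneSet hz)).1 (h hz)).2⟩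
  · rintro ⟨h1, h2⟩ z hz
    exact (notMem_hullProduct_iff hT hA₂ (K.subset_upperHalfPlaneSet hz)).2 ⟨h1 hz, h2 z hz⟩

/-- Avoidance only depends on the part of the hull in `ℍ`: hulls with the same complement in
`ℍ` have the same avoidance event. [folklore] -/
theorem avoid_eq_of_diff_eq {B B' : Set ℂ}
    (h : upperHalfPlaneSet \ B = upperHalfPlaneSet \ B') : avoid B = avoid B' := by
  ext K
  rw [mem_avoid, mem_avoid, Set.disjoint_left, Set.disjoint_left]
  constructor
  · intro hK z hz hzB
    have : z ∈ upperHalfPlaneSet \ B := ⟨K.subset_upperHalfPlaneSet hz, hK hz⟩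
    rw [h] at this
    exact this.2 hzB
  · intro hK z hz hzB
    have : z ∈ upperHalfPlaneSet \ B' := ⟨K.subset_upperHalfPlaneSet hz, hK hz⟩
    rw [← h] at this
    exact this.2 hzB

/-- The avoidance event of an abstract product `IsHullProduct A A' B` is that of the constructed
product `hullProduct A A' Φ'` for any restriction map `Φ'` of `A'` (uniqueness of `Φ_{A'}`). [folklore] -/
theorem avoid_eq_avoid_hullProduct (hexΦ : IsStarHull.existsUnique_isRestrictionMap)
    {A A' B : Set ℂ} (hA : IsStarHull A) (hA' : IsStarHull A') (hB : IsHullProduct A A' B)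
    {Φ' : ConformalEquiv (upperHalfPlaneSet \ A') upperHalfPlaneSet} (hΦ' : IsRestrictionMap A' Φ') :
    avoid B = avoid (hullProduct A A' Φ') := by
  obtain ⟨-, Φ₀, hΦ₀, hBeq⟩ := hB
  obtain ⟨Φ₁, -, huniq⟩ := hexΦ hA'
  have heq : EqOn Φ₀ Φ' (upperHalfPlaneSet \ A') :=
    (huniq Φ₀ hΦ₀).trans (huniq Φ' hΦ').symm
  refine avoid_eq_of_diff_eq ?_
  rw [hBeq, ← hullProduct_congr heq,
    diff_hullProduct hA.isBoundedHull.isClosed hA'.isBoundedHull.isClosed]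

end RestrictionConfig

open RestrictionConfig

/-! ### Two measure-theoretic limit lemmas -/

section MeasureLimits

variable {Ω' : Type*} [MeasurableSpace Ω'] {P : Measure Ω'}

/-- **Fatou from below**: if every point of `C` lies in `B n` for all large `n` and
`P (B n) → b`, then `P C ≤ b`. [folklore] -/
theorem measure_le_of_forall_eventually_mem {C : Set Ω'} {B : ℕ → Set Ω'} {b : ℝ≥0∞}
    (hC : ∀ x ∈ C, ∀ᶠ n in atTop, x ∈ B n) (hb : Tendsto (fun n ↦ P (B n)) atTop (𝓝 b)) :
    P C ≤ b := by
  set D : ℕ → Set Ω' := fun N ↦ ⋂ n, ⋂ (_ : N ≤ n), B n with hD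
  have hDm : Monotone D := fun N N' h ↦ by
    simp only [hD]
    exact iInter_mono fun n ↦ iInter_mono' fun hn ↦ ⟨h.trans hn, Subset.rfl⟩
  have hCD : C ⊆ ⋃ N, D N := fun x hx ↦ by
    obtain ⟨N, hN⟩ := eventually_atTop.1 (hC x hx)
    exact mem_iUnion.2 ⟨N, mem_iInter₂.2 fun n hn ↦ hN n hn⟩
  have hDt : Tendsto (fun N ↦ P (D N)) atTop (𝓝 (P (⋃ N, D N))) := tendsto_measure_iUnion_atTop hDm
  have hDB : ∀ N, P (D N) ≤ P (B N) := fun N ↦ measure_mono (fun x hx ↦ (mem_iInter₂.1 hx) N le_rfl)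
  exact (measure_mono hCD).trans (le_of_tendsto_of_tendsto' hDt hb hDB)

/-- **Fatou from above** (finite measure): if membership in `B n` for infinitely many `n`
forces membership in `C`, and `P (B n) → b` with `B n` measurable, then `b ≤ P C`. [folklore] -/
theorem le_measure_of_frequently_mem [IsFiniteMeasure P] {C : Set Ω'} {B : ℕ → Set Ω'}
    {b : ℝ≥0∞} (hBm : ∀ n, MeasurableSet (B n))
    (hC : ∀ x, (∃ᶠ n in atTop, x ∈ B n) → x ∈ C) (hb : Tendsto (fun n ↦ P (B n)) atTop (𝓝 b)) :
    b ≤ P C := by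
  set G : ℕ → Set Ω' := fun N ↦ ⋃ n, ⋃ (_ : N ≤ n), B n with hG
  have hGa : Antitone G := fun N N' h ↦ by
    simp only [hG]
    exact iUnion_mono fun n ↦ iUnion_subset fun hn ↦ subset_iUnion (fun _ ↦ B n) (h.trans hn)
  have hGm : ∀ N, NullMeasurableSet (G N) P := fun N ↦
    (MeasurableSet.iUnion fun n ↦ MeasurableSet.iUnion fun _ ↦ hBm n).nullMeasurableSet
  have hGt : Tendsto (fun N ↦ P (G N)) atTop (𝓝 (P (⋂ N, G N))) :=
    tendsto_measure_iInter_atTop hGm hGa ⟨0, measure_ne_top P _⟩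
  have hBG : ∀ N, P (B N) ≤ P (G N) := fun N ↦
    measure_mono (fun x hx ↦ mem_iUnion₂.2 ⟨N, le_rfl, hx⟩)
  have hGC : (⋂ N, G N) ⊆ C := fun x hx ↦ by
    refine hC x (frequently_atTop.2 fun N ↦ ?_)
    obtain ⟨n, hn, hxn⟩ := mem_iUnion₂.1 (mem_iInter.1 hx N)
    exact ⟨n, hn, hxn⟩
  exact (le_of_tendsto_of_tendsto' hb hGt hBG).trans (measure_mono hGC)

end MeasureLimits

/-! ### The approximation argument -/

section Approx

variable {A A' : Set ℂ} {J : ℕ → Set ℂ}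
  {Φ' : ConformalEquiv (upperHalfPlaneSet \ A') upperHalfPlaneSet}
  {Ψ : ∀ n, ConformalEquiv (upperHalfPlaneSet \ J n) upperHalfPlaneSet}

/-- A configuration `K` avoiding `A'` avoids the real filling `F ⊇ A'` (`F ∩ ℍ ⊆ A'`, `0 ∉ F`),
even after closure (`cl K ⊆ K ∪ {0}`). [folklore] -/
theorem RestrictionConfig.disjoint_closure_fill (K : RestrictionConfig) {F : Set ℂ}
    (hA'F : A' ⊆ F) (hFA' : F ∩ upperHalfPlaneSet ⊆ A') (h0F : (0 : ℂ) ∉ F)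
    (hK : Disjoint (K : Set ℂ) A') : Disjoint (closure (K : Set ℂ)) F := by
  have h0A' : (0 : ℂ) ∉ A' := fun h ↦ h0F (hA'F h)
  refine Set.disjoint_left.2 fun z hz hzF ↦ ?_
  rcases K.closure_subset hz with hzK | hz0
  · exact Set.disjoint_left.1 hK hzK (hFA' ⟨hzF, K.subset_upperHalfPlaneSet hzK⟩)
  · rw [mem_singleton_iff] at hz0
    exact h0F (hz0 ▸ hzF)

/-- A configuration avoiding `A'` avoids `J n` for all large `n`, where the decreasing bounded
closed `J n` have intersection `F ⊇ A'` with `F ∩ ℍ ⊆ A'`, `0 ∉ F` (the real filling): only the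
compact part `cl(K ∩ B(0, R)) ⊆ K ∪ {0}` of `K` can meet the `J n ⊆ B(0, R)`. [folklore] -/
theorem RestrictionConfig.eventually_disjoint (hJs : ∀ n, IsStarHull (J n))
    (hJm : Antitone J) {F : Set ℂ} (hJi : (⋂ n, J n) = F) (hA'F : A' ⊆ F)
    (hFA' : F ∩ upperHalfPlaneSet ⊆ A') (h0F : (0 : ℂ) ∉ F) (K : RestrictionConfig)
    (hK : Disjoint (K : Set ℂ) A') : ∀ᶠ n in atTop, Disjoint (K : Set ℂ) (J n) := by
  obtain ⟨R, hR⟩ := (hJs 0).isBoundedHull.1.subset_closedBall 0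
  set C : Set ℂ := closure ((K : Set ℂ) ∩ closedBall 0 R) with hC
  have hCcpt : IsCompact C :=
    (isCompact_closedBall (0 : ℂ) R).of_isClosed_subset isClosed_closure
      (closure_minimal inter_subset_right isClosed_closedBall)
  have hCA : Disjoint C F :=
    (K.disjoint_closure_fill hA'F hFA' h0F hK).mono_left (closure_mono inter_subset_left)
  have hev := eventually_disjoint_of_iInter_eq (fun n ↦ (hJs n).isBoundedHull.isClosed) hJm hJi
    hCcpt hCA
  filter_upwards [hev] with n hn
  refine Set.disjoint_left.2 fun z hz hzJ ↦ ?_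
  have hzR : z ∈ closedBall (0 : ℂ) R := hR (hJm (Nat.zero_le n) hzJ)
  exact Set.disjoint_left.1 hn (subset_closure ⟨hz, hzR⟩) hzJ

/-- `P[K ∩ J n = ∅] → P[K ∩ A' = ∅]` for `J n ↓ A'`: the avoidance events increase to the
avoidance event of `A'`. [folklore] -/
theorem tendsto_measure_avoid (P : Measure RestrictionConfig)
    (hJs : ∀ n, IsStarHull (J n)) (hJm : Antitone J) {F : Set ℂ} (hJi : (⋂ n, J n) = F)
    (hA'F : A' ⊆ F) (hFA' : F ∩ upperHalfPlaneSet ⊆ A') (h0F : (0 : ℂ) ∉ F) :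
    Tendsto (fun n ↦ P (avoid (J n))) atTop (𝓝 (P (avoid A'))) := by
  have hmono : Monotone fun n ↦ avoid (J n) := fun m n hmn K hK ↦
    (show Disjoint (K : Set ℂ) (J m) from hK).mono_right (hJm hmn)
  have hU : (⋃ n, avoid (J n)) = avoid A' := by
    refine Subset.antisymm (iUnion_subset fun n K hK ↦ ?_) fun K hK ↦ ?_
    · exact (show Disjoint (K : Set ℂ) (J n) from hK).mono_right
        (hA'F.trans (subset_of_iInter_eq hJi n))
    · obtain ⟨n, hn⟩ :=
        (RestrictionConfig.eventually_disjoint hJs hJm hJi hA'F hFA' h0F K hK).exists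
      exact mem_iUnion.2 ⟨n, hn⟩
  rw [← hU]
  exact tendsto_measure_iUnion_atTop hmono

/-- **Eventual avoidance of `T · J n`.** If `K ∩ A' = ∅` and `Φ'(K) ∩ T = ∅` for a closed bounded
`T ∌ 0`, then `K ∩ (T · J n) = ∅` for all large `n`. [folklore] -/
theorem eventually_mem_avoid_hullProduct (hA' : IsStarHull A') (hJs : ∀ n, IsStarHull (J n))
    (hJm : Antitone J) {F : Set ℂ} (hJi : (⋂ n, J n) = F) (hA'F : A' ⊆ F)
    (hFA' : F ∩ upperHalfPlaneSet ⊆ A') (h0F : (0 : ℂ) ∉ F) (hΦ' : IsRestrictionMap A' Φ')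
    (hΨ : ∀ n, IsRestrictionMap (J n) (Ψ n))
    (huc : ∀ S ⊆ upperHalfPlaneSet, IsCompact (closure S) → Disjoint (closure S) F →
      TendstoUniformlyOn (fun n z ↦ Ψ n z) (fun z ↦ Φ' z) atTop S)
    {T : Set ℂ} (hT : IsClosed T) (hTb : IsBounded T) (h0T : (0 : ℂ) ∉ T)
    (K : RestrictionConfig) (hK : Disjoint (K : Set ℂ) A') (hKT : ∀ z ∈ (K : Set ℂ), Φ' z ∉ T) :
    ∀ᶠ n in atTop, K ∈ avoid (hullProduct T (J n) (Ψ n)) := by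
  have hA'c : IsClosed A' := hA'.isBoundedHull.isClosed
  have hKU : (K : Set ℂ) ⊆ upperHalfPlaneSet \ A' := K.subset_diff_of_disjoint hK
  -- far field
  obtain ⟨M, hM⟩ := hTb.subset_closedBall 0
  obtain ⟨R, -, hfar⟩ :=
    exists_forall_lt_norm_apply hJs hJm (subset_of_iInter_eq hJi) hA'F hΦ' hΨ huc M
  -- near field
  set S : Set ℂ := (K : Set ℂ) ∩ closedBall 0 R with hS
  have hSU : S ⊆ upperHalfPlaneSet \ A' := inter_subset_left.trans hKU
  have hScl : closure S ⊆ (K : Set ℂ) ∪ {0} := (closure_mono inter_subset_left).trans K.closure_subset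
  have hScpt : IsCompact (closure S) :=
    (isCompact_closedBall (0 : ℂ) R).of_isClosed_subset isClosed_closure
      (closure_minimal inter_subset_right isClosed_closedBall)
  have hSA' : Disjoint (closure S) F :=
    (K.disjoint_closure_fill hA'F hFA' h0F hK).mono_left (closure_mono inter_subset_left)
  obtain ⟨η, hη, hgap⟩ := hΦ'.exists_pos_forall_le_dist hA'c hSU hScpt
    (hScl.trans (union_subset_union_left _ hKU)) hT h0T (fun z hz hzU ↦ by
      rcases hScl hz with hzK | hz0
      · exact hKT z hzK
      · exfalso
        rw [mem_singleton_iff] at hz0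
        subst hz0
        have : (0 : ℝ) < (0 : ℂ).im := hzU.1
        simp at this)
  have hucS := huc S (hSU.trans sdiff_subset) hScpt hSA'
  rw [Metric.tendstoUniformlyOn_iff] at hucS
  filter_upwards [hfar, RestrictionConfig.eventually_disjoint hJs hJm hJi hA'F hFA' h0F K hK,
    hucS η hη] with n h1 h2 h3
  rw [mem_avoid_hullProduct_iff hT (hJs n).isBoundedHull.isClosed]
  refine ⟨h2, fun z hz hzT ↦ ?_⟩
  by_cases hzR : ‖z‖ ≤ R
  · have hzS : z ∈ S := ⟨hz, mem_closedBall_zero_iff.2 hzR⟩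
    have := hgap z hzS _ hzT
    linarith [h3 z hzS]
  · have hzJ : z ∈ upperHalfPlaneSet \ J n := ⟨K.subset_upperHalfPlaneSet hz, Set.disjoint_left.1 h2 hz⟩
    have hlt := h1 z hzJ (not_le.1 hzR)
    have := hM hzT
    rw [mem_closedBall, dist_zero_right] at this
    linarith

/-- **Frequent avoidance of `T' · J n` forces avoidance of `T · A'`** when `T ∩ ℍ ⊆ int T'`:
`K ∩ J n = ∅` gives `K ∩ A' = ∅`, and a point `Φ'(z) ∈ T ∩ ℍ` would put `Ψ n z` inside `T'` for
all large `n` (pointwise convergence). [folklore] -/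
theorem mem_of_frequently_mem_avoid_hullProduct (hJs : ∀ n, IsStarHull (J n))
    {F : Set ℂ} (hJi : (⋂ n, J n) = F) (hA'F : A' ⊆ F) (hFA' : F ∩ upperHalfPlaneSet ⊆ A')
    (huc : ∀ S ⊆ upperHalfPlaneSet, IsCompact (closure S) → Disjoint (closure S) F →
      TendstoUniformlyOn (fun n z ↦ Ψ n z) (fun z ↦ Φ' z) atTop S)
    {T T' : Set ℂ} (hT' : IsClosed T') (hTT' : T ∩ upperHalfPlaneSet ⊆ interior T')
    (K : RestrictionConfig) (hK : ∃ᶠ n in atTop, K ∈ avoid (hullProduct T' (J n) (Ψ n))) :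
    Disjoint (K : Set ℂ) A' ∧ ∀ z ∈ (K : Set ℂ), Φ' z ∉ T := by
  have hK' : ∃ᶠ n in atTop, Disjoint (K : Set ℂ) (J n) ∧ ∀ z ∈ (K : Set ℂ), Ψ n z ∉ T' :=
    hK.mono fun n hn ↦ (mem_avoid_hullProduct_iff hT' (hJs n).isBoundedHull.isClosed).1 hn
  obtain ⟨n₀, hn₀, -⟩ := hK'.exists
  have hKF : Disjoint (K : Set ℂ) F := hn₀.mono_right (subset_of_iInter_eq hJi n₀)
  have hKA' : Disjoint (K : Set ℂ) A' := hKF.mono_right hA'F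
  refine ⟨hKA', fun z hz hzT ↦ ?_⟩
  have hzU : z ∈ upperHalfPlaneSet \ A' := K.subset_diff_of_disjoint hKA' hz
  have hΦz : Φ' z ∈ interior T' := hTT' ⟨hzT, Φ'.mapsTo hzU⟩
  -- pointwise convergence at `z`
  have hpt : Tendsto (fun n ↦ Ψ n z) atTop (𝓝 (Φ' z)) := by
    have h := huc {z} (singleton_subset_iff.2 hzU.1) (by rw [closure_singleton]; exact isCompact_singleton)
      (by rw [closure_singleton, disjoint_singleton_left]; exact fun hzF ↦ hzU.2 (hFA' ⟨hzF, hzU.1⟩))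
    exact h.tendsto_at (mem_singleton z)
  have hev : ∀ᶠ n in atTop, Ψ n z ∈ T' :=
    (hpt.eventually (mem_interior_iff_mem_nhds.1 hΦz))
  obtain ⟨n, ⟨-, hn⟩, hn'⟩ := (hK'.and_eventually hev).exists
  exact hn z hz hn'

/-- **`F(A · A') = F(A) F(A')` for `A ∈ 𝒬*` and `A' ∈ 𝒬₊ ∪ 𝒬₋`** (through `HasArcApprox A'`),
for a probability measure on `Ω` whose avoidance probabilities are multiplicative over smooth
hulls — the limit argument of the module docstring. [cite: LawlerSchrammWerner2003Restriction, Prop. 3.3 (1) (p. 10) with Lemma 2.1 (p. 8)] -/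
theorem measure_avoid_hullProduct_of_hasArcApprox
    (hexΦ : IsStarHull.existsUnique_isRestrictionMap)
    (hFa : isSimplyConnected_of_isConnected_compl)
    {P : Measure RestrictionConfig} [IsProbabilityMeasure P] (hP : IsArcHullMultiplicative P)
    (hA : IsStarHull A) (hA' : IsStarHull A') (happ : HasArcApprox A')
    (hΦ' : IsRestrictionMap A' Φ') :
    P (avoid (hullProduct A A' Φ')) = P (avoid A) * P (avoid A') := by
  classical
  have hAc : IsClosed A := hA.isBoundedHull.isClosed
  have hA'c : IsClosed A' := hA'.isBoundedHull.isClosed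
  have hAcl : A ⊆ closure upperHalfPlaneSet := hA.isBoundedHull.subset_closure
  -- the approximating smooth hulls and their restriction maps
  obtain ⟨J, F, hJa, hJs, hJm, hJi, hA'F, hFA', h0F, hconv⟩ := happ
  have hΨex : ∀ n, ∃ Ψn : ConformalEquiv (upperHalfPlaneSet \ J n) upperHalfPlaneSet,
      IsRestrictionMap (J n) Ψn := fun n ↦
    let ⟨Ψn, hΨn, _⟩ := hexΦ (hJs n); ⟨Ψn, hΨn⟩
  choose Ψ hΨ using hΨex
  have huc := hconv Φ' Ψ hΦ' hΨ
  -- the thickened hulls `T k = thickHull A (s k)`, `s k ↓ 0`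
  obtain ⟨s₀, hs₀, hstar⟩ := exists_forall_isStarHull_thickHull hFa hA
  set s : ℕ → ℝ := fun k ↦ s₀ / (k + 2) with hs
  have hspos : ∀ k, 0 < s k := fun k ↦ by rw [hs]; positivity
  have hslt : ∀ k, s k < s₀ := fun k ↦ by
    rw [hs]
    simp only
    rw [div_lt_iff₀ (by positivity)]
    nlinarith
  have hsanti : ∀ k, s (k + 1) < s k := fun k ↦ by
    rw [hs]
    simp only
    push_cast
    exact div_lt_div_of_pos_left hs₀ (by positivity) (by linarith)
  have hsto : Tendsto s atTop (𝓝 0) := by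
    rw [hs]
    have h1 : Tendsto (fun k : ℕ ↦ ((k : ℝ) + 2)) atTop atTop :=
      tendsto_atTop_add_const_right _ 2 tendsto_natCast_atTop_atTop
    exact tendsto_const_nhds.div_atTop h1
  set T : ℕ → Set ℂ := fun k ↦ thickHull A (s k) with hT
  have hTs : ∀ k, IsStarHull (T k) := fun k ↦ hstar (s k) (hspos k).le (hslt k)
  have hTc : ∀ k, IsClosed (T k) := fun k ↦ (hTs k).isBoundedHull.isClosed
  have hT0 : ∀ k, (0 : ℂ) ∉ T k := fun k ↦ (hTs k).zero_notMem
  have hTanti : ∀ k, T (k + 1) ⊆ T k := fun k ↦ thickHull_mono A (hsanti k).le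
  have hTint : ∀ k, T (k + 1) ∩ upperHalfPlaneSet ⊆ interior (T k) := fun k ↦
    thickHull_inter_subset_interior hA.isBoundedHull.1 (hspos (k + 1)).le (hsanti k)
  have hAT : ∀ k, A ∩ upperHalfPlaneSet ⊆ T k := fun k ↦ inter_subset_thickHull hAcl (s k)
  -- the events `C k`
  set C : ℕ → Set RestrictionConfig := fun k ↦
    {K | Disjoint (K : Set ℂ) A' ∧ ∀ z ∈ (K : Set ℂ), Φ' z ∉ T k} with hC
  -- smooth multiplicativity along `J n`
  have hb : ∀ k, Tendsto (fun n ↦ P (avoid (hullProduct (T k) (J n) (Ψ n)))) atTop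
      (𝓝 (P (avoid (T k)) * P (avoid A'))) := fun k ↦ by
    have heq : ∀ n, P (avoid (hullProduct (T k) (J n) (Ψ n))) = P (avoid (T k)) * P (avoid (J n)) :=
      fun n ↦ hP (T k) (J n) _ (hTs k) (hJa n) (hJs n) (isHullProduct_hullProduct (hTs k) (hJs n) (hΨ n))
    simp_rw [heq]
    exact ENNReal.Tendsto.const_mul (tendsto_measure_avoid P hJs hJm hJi hA'F hFA' h0F)
      (Or.inr (measure_ne_top _ _))
  -- lower bound: `P (C k) ≤ F(T k) F(A')`
  have hL : ∀ k, P (C k) ≤ P (avoid (T k)) * P (avoid A') := fun k ↦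
    measure_le_of_forall_eventually_mem (fun K hK ↦ eventually_mem_avoid_hullProduct hA' hJs hJm
      hJi hA'F hFA' h0F hΦ' hΨ huc (hTc k) (hTs k).isBoundedHull.1 (hT0 k) K hK.1 hK.2) (hb k)
  -- upper bound: `F(T k) F(A') ≤ P (C (k+1))`
  have hU : ∀ k, P (avoid (T k)) * P (avoid A') ≤ P (C (k + 1)) := fun k ↦
    le_measure_of_frequently_mem
      (fun n ↦ measurableSet_avoid ((hTs k).hullProduct (hJs n) (hΨ n)))
      (fun K hK ↦ mem_of_frequently_mem_avoid_hullProduct hJs hJi hA'F hFA' huc (hTc k) (hTint k) K hK)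
      (hb k)
  -- limits as `k → ∞`
  have hTto : Tendsto (fun k ↦ P (avoid (T k))) atTop (𝓝 (P (avoid A))) := by
    have hmono : Monotone fun k ↦ avoid (T k) := by
      refine monotone_nat_of_le_succ fun k K hK ↦ ?_
      exact (show Disjoint (K : Set ℂ) (T k) from hK).mono_right (hTanti k)
    have hUn : (⋃ k, avoid (T k)) = avoid A := by
      refine Subset.antisymm (iUnion_subset fun k K hK ↦ ?_) fun K hK ↦ ?_
      · refine Set.disjoint_left.2 fun z hz hzA ↦ ?_
        exact Set.disjoint_left.1 (show Disjoint (K : Set ℂ) (T k) from hK) hz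
          (hAT k ⟨hzA, K.subset_upperHalfPlaneSet hz⟩)
      · obtain ⟨s₁, hs₁, hdisj⟩ := exists_forall_disjoint_thickHull hA.isBoundedHull.isCompact
          K.subset_upperHalfPlaneSet K.isConnected.isPreconnected K.not_isBounded
          (K.disjoint_closure_of_disjoint hA.zero_notMem hK)
        obtain ⟨k, hk⟩ := ((tendsto_order.1 hsto).2 s₁ hs₁).exists
        exact mem_iUnion.2 ⟨k, hdisj (s k) hk.le⟩
    rw [← hUn]
    exact tendsto_measure_iUnion_atTop hmono
  have hCto : Tendsto (fun k ↦ P (C k)) atTop (𝓝 (P (avoid (hullProduct A A' Φ')))) := by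
    have hmono : Monotone C := by
      refine monotone_nat_of_le_succ fun k K hK ↦ ⟨hK.1, fun z hz hzT ↦ hK.2 z hz (hTanti k hzT)⟩
    have hUn : (⋃ k, C k) = avoid (hullProduct A A' Φ') := by
      refine Subset.antisymm (iUnion_subset fun k K hK ↦ ?_) fun K hK ↦ ?_
      · rw [mem_avoid_hullProduct_iff hAc hA'c]
        refine ⟨hK.1, fun z hz hzA ↦ hK.2 z hz (hAT k ⟨hzA, ?_⟩)⟩
        exact Φ'.mapsTo (K.subset_diff_of_disjoint hK.1 hz)
      · rw [mem_avoid_hullProduct_iff hAc hA'c] at hK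
        have hKU : (K : Set ℂ) ⊆ upperHalfPlaneSet \ A' := K.subset_diff_of_disjoint hK.1
        set L : Set ℂ := Φ' '' (K : Set ℂ) with hLdef
        have hL : L ⊆ upperHalfPlaneSet := by
          rintro _ ⟨z, hz, rfl⟩
          exact Φ'.mapsTo (hKU hz)
        have hLc : IsPreconnected L :=
          K.isConnected.isPreconnected.image _ (Φ'.continuousOn.mono hKU)
        have hLb : ¬ IsBounded L := hΦ'.not_isBounded_image hKU K.not_isBounded
        have hLA : Disjoint (closure L) A := by
          refine Set.disjoint_left.2 fun w hw hwA ↦ ?_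
          rcases hΦ'.closure_image_subset hA'c hKU K.closure_subset hw with ⟨z, hz, rfl⟩ | hw0
          · exact hK.2 z hz hwA
          · rw [mem_singleton_iff] at hw0
            exact hA.zero_notMem (hw0 ▸ hwA)
        obtain ⟨s₁, hs₁, hdisj⟩ := exists_forall_disjoint_thickHull hA.isBoundedHull.isCompact
          hL hLc hLb hLA
        obtain ⟨k, hk⟩ := ((tendsto_order.1 hsto).2 s₁ hs₁).exists
        refine mem_iUnion.2 ⟨k, hK.1, fun z hz hzT ↦ ?_⟩
        exact Set.disjoint_left.1 (hdisj (s k) hk.le) ⟨z, hz, rfl⟩ hzT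
    rw [← hUn]
    exact tendsto_measure_iUnion_atTop hmono
  -- squeeze
  have hlim : Tendsto (fun k ↦ P (avoid (T k)) * P (avoid A')) atTop (𝓝 (P (avoid A) * P (avoid A'))) :=
    ENNReal.Tendsto.mul_const hTto (Or.inr (measure_ne_top _ _))
  have hsq : Tendsto (fun k ↦ P (C (k + 1))) atTop (𝓝 (P (avoid A) * P (avoid A'))) :=
    tendsto_of_tendsto_of_tendsto_of_le_of_le hlim (hlim.comp (tendsto_add_atTop_nat 1))
      (fun k ↦ hU k) (fun k ↦ hL (k + 1))
  have hCto' : Tendsto (fun k ↦ P (C (k + 1))) atTop (𝓝 (P (avoid (hullProduct A A' Φ')))) :=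
    hCto.comp (tendsto_add_atTop_nat 1)
  exact tendsto_nhds_unique hCto' hsq

end Approx

/-! ### Associativity of the hull product and the upgrade to all `*`-hulls -/

section Assoc

variable {A A₁ A₂ : Set ℂ} {Φ₁ : ConformalEquiv (upperHalfPlaneSet \ A₁) upperHalfPlaneSet}
  {Φ₂ : ConformalEquiv (upperHalfPlaneSet \ A₂) upperHalfPlaneSet}

/-- **Associativity of the hull product on complements**:
`ℍ ∖ (A · (A₁ · A₂)) = ℍ ∖ ((A · A₁) · A₂)`, both being `(Φ_{A₁} ∘ Φ_{A₂})⁻¹(ℍ ∖ A)`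
([LSW] §2 p. 8: `𝒬*` "is a semigroup"). [cite: LawlerSchrammWerner2003Restriction, §2 p. 8 (Semigroups)] -/
theorem diff_hullProduct_assoc (hA : IsClosed A) (hA₁ : IsClosed A₁) (hA₂ : IsClosed A₂) :
    upperHalfPlaneSet \ hullProduct A (hullProduct A₁ A₂ Φ₂) (hullProductMap Φ₁ Φ₂ hA₁ hA₂) =
      upperHalfPlaneSet \ hullProduct (hullProduct A A₁ Φ₁) A₂ Φ₂ := by
  rw [diff_hullProduct hA isClosed_hullProduct, diff_hullProduct isClosed_hullProduct hA₂]
  ext z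
  simp only [mem_setOf_eq, hullProductMap_apply]
  constructor
  · rintro ⟨⟨hz, hzB⟩, hzA⟩
    obtain ⟨hz₂, hz₁⟩ := (notMem_hullProduct_iff hA₁ hA₂ hz).1 hzB
    exact ⟨⟨hz, hz₂⟩, (notMem_hullProduct_iff hA hA₁ (Φ₂.mapsTo ⟨hz, hz₂⟩)).2 ⟨hz₁, hzA⟩⟩
  · rintro ⟨⟨hz, hz₂⟩, hzB⟩
    obtain ⟨hz₁, hzA⟩ := (notMem_hullProduct_iff hA hA₁ (Φ₂.mapsTo ⟨hz, hz₂⟩)).1 hzB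
    exact ⟨⟨hz, (notMem_hullProduct_iff hA₁ hA₂ hz).2 ⟨hz₂, hz₁⟩⟩, hzA⟩

/-- Bounded hulls with the same complement in `ℍ` coincide (each is the closure of its part in
`ℍ`). [folklore] -/
theorem IsBoundedHull.eq_of_diff_eq {B₁ B₂ : Set ℂ} (h₁ : IsBoundedHull B₁) (h₂ : IsBoundedHull B₂)
    (h : upperHalfPlaneSet \ B₁ = upperHalfPlaneSet \ B₂) : B₁ = B₂ := by
  have h' : B₁ ∩ upperHalfPlaneSet = B₂ ∩ upperHalfPlaneSet := by
    rw [inter_comm, ← sdiff_sdiff_right_self, h, sdiff_sdiff_right_self, inter_comm]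
  rw [← h₁.closure_inter_eq, h', h₂.closure_inter_eq]

end Assoc

/-- `F(A · ∅) = F(A) F(∅)`: a restriction map of the empty hull is the identity on `ℍ`, so
`A · ∅ = A`, and `F(∅) = 1`. [folklore] -/
theorem measure_avoid_hullProduct_empty (hexΦ : IsStarHull.existsUnique_isRestrictionMap)
    {P : Measure RestrictionConfig} [IsProbabilityMeasure P] {A : Set ℂ} (hA : IsStarHull A)
    {Φ' : ConformalEquiv (upperHalfPlaneSet \ ∅) upperHalfPlaneSet} (hΦ' : IsRestrictionMap ∅ Φ') :
    P (avoid (hullProduct A ∅ Φ')) = P (avoid A) * P (avoid ∅) := by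
  obtain ⟨Φ₁, -, huniq⟩ := hexΦ isStarHull_empty
  have heq : EqOn Φ' restrictionMapEmpty (upperHalfPlaneSet \ ∅) :=
    (huniq Φ' hΦ').trans (huniq _ isRestrictionMap_empty).symm
  have hav : avoid (hullProduct A ∅ Φ') = avoid A := by
    refine avoid_eq_of_diff_eq ?_
    rw [diff_hullProduct hA.isBoundedHull.isClosed isClosed_empty]
    ext z
    simp only [mem_setOf_eq, sdiff_empty, Set.mem_sdiff]
    constructor
    · rintro ⟨hz, hzA⟩
      rw [heq (by simpa using hz), restrictionMapEmpty_apply] at hzA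
      exact ⟨hz, hzA⟩
    · rintro ⟨hz, hzA⟩
      refine ⟨hz, ?_⟩
      rw [heq (by simpa using hz), restrictionMapEmpty_apply]
      exact hzA
  rw [hav, avoid_empty, measure_univ, mul_one]

/-- `F(A · A') = F(A) F(A')` for `A' ∈ 𝒬₊ ∪ 𝒬₋` (empty or not). [cite: LawlerSchrammWerner2003Restriction, Prop. 3.3 (1) (p. 10) with Lemma 2.1 (p. 8)] -/
theorem measure_avoid_hullProduct_of_plus_or_minus (h21 : IsPlusHull.exists_antitone_isArcHull)
    (hexΦ : IsStarHull.existsUnique_isRestrictionMap)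
    (hFa : isSimplyConnected_of_isConnected_compl)
    {P : Measure RestrictionConfig} [IsProbabilityMeasure P] (hP : IsArcHullMultiplicative P)
    {A A' : Set ℂ} (hA : IsStarHull A) (hA' : IsPlusHull A' ∨ IsMinusHull A')
    {Φ' : ConformalEquiv (upperHalfPlaneSet \ A') upperHalfPlaneSet} (hΦ' : IsRestrictionMap A' Φ') :
    P (avoid (hullProduct A A' Φ')) = P (avoid A) * P (avoid A') := by
  rcases A'.eq_empty_or_nonempty with rfl | hne
  · exact measure_avoid_hullProduct_empty hexΦ hA hΦ'
  · have hA's : IsStarHull A' := hA'.elim (fun h ↦ h.1) (fun h ↦ h.1)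
    exact measure_avoid_hullProduct_of_hasArcApprox hexΦ hFa hP hA hA's
      (hasArcApprox_of_plus_or_minus h21 hA' hne) hΦ'

/-- **[LSW] Prop. 3.3, hypothesis (1), from restriction over smooth hulls.** For a probability
measure `P` on `Ω`, multiplicativity of the avoidance probabilities over SMOOTH `*`-hulls
(`IsArcHullMultiplicative`, i.e. what two-sided restriction over Jordan hull subdomains gives)
implies multiplicativity over all `*`-hulls (`IsHullMultiplicative`, the homomorphism form of
`𝒜₁`-covariance): write `A' = A₁ · A₂` with `A₁ ∈ 𝒬₊`, `A₂ ∈ 𝒬₋` ([LSW] §2 p. 8), approximate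
`A₁`, `A₂` from outside by smooth hulls ([LSW] Lemma 2.1, by reflection for `𝒬₋`) and pass to
the limit (`measure_avoid_hullProduct_of_hasArcApprox`; empty factors are trivial), then
reassemble by associativity: `F(A · A') = F((A · A₁) · A₂) = F(A) F(A₁) F(A₂) = F(A) F(A')`.
Hypotheses: the named facts `h21` (Lemma 2.1 with the Lemma 3.5 convergence), `hfac`
(`±`-factorisation), `hexΦ` (existence/uniqueness of `Φ_A`) and `hFa` (Conway VIII.2.2, for
the thickened hulls).
[cite: LawlerSchrammWerner2003Restriction, Prop. 3.3 (1) (p. 10) with §2 p. 8 and Lemma 2.1] -/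
theorem RestrictionConfig.IsArcHullMultiplicative.isHullMultiplicative
    (h21 : IsPlusHull.exists_antitone_isArcHull)
    (hfac : IsStarHull.exists_isHullProduct_plus_minus)
    (hexΦ : IsStarHull.existsUnique_isRestrictionMap)
    (hFa : isSimplyConnected_of_isConnected_compl)
    {P : Measure RestrictionConfig} [IsProbabilityMeasure P] (hP : IsArcHullMultiplicative P) :
    IsHullMultiplicative P := by
  intro A A' B hA hA' hB
  have hAc : IsClosed A := hA.isBoundedHull.isClosed
  -- factorise `A' = A₁ · A₂`
  obtain ⟨A₁, A₂, hA₁, hA₂, hprod⟩ := hfac hA'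
  have hA₁c : IsClosed A₁ := hA₁.1.isBoundedHull.isClosed
  have hA₂c : IsClosed A₂ := hA₂.1.isBoundedHull.isClosed
  obtain ⟨-, Φ₂, hΦ₂, hA'eq⟩ := hprod
  obtain ⟨Φ₁, hΦ₁, -⟩ := hexΦ hA₁.1
  have hA'' : A' = hullProduct A₁ A₂ Φ₂ := by
    refine hA'.isBoundedHull.eq_of_diff_eq (hA₁.1.hullProduct hA₂.1 hΦ₂).isBoundedHull ?_
    rw [hA'eq, diff_hullProduct hA₁c hA₂c]
  subst hA''
  -- the product `A · (A₁ · A₂)` through the restriction map `Φ₁ ∘ Φ₂`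
  have hΦ₁₂ : IsRestrictionMap (hullProduct A₁ A₂ Φ₂) (hullProductMap Φ₁ Φ₂ hA₁c hA₂c) :=
    IsRestrictionMap.hullProduct hA₁c hA₂c hΦ₁ hΦ₂
  rw [avoid_eq_avoid_hullProduct hexΦ hA hA' hB hΦ₁₂,
    avoid_eq_of_diff_eq (diff_hullProduct_assoc hAc hA₁c hA₂c)]
  -- three applications of the limit theorem
  have e1 := measure_avoid_hullProduct_of_plus_or_minus h21 hexΦ hFa hP
    (hA.hullProduct hA₁.1 hΦ₁) (Or.inr hA₂) hΦ₂
  have e2 := measure_avoid_hullProduct_of_plus_or_minus h21 hexΦ hFa hP hA (Or.inl hA₁) hΦ₁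
  have e3 := measure_avoid_hullProduct_of_plus_or_minus h21 hexΦ hFa hP hA₁.1 (Or.inr hA₂) hΦ₂
  rw [e1, e2, e3, mul_assoc]

end Literature.Probability.RandomPlanarGeometry

end
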